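import Summits.RiemannHypothesis.RiemannHypothesis.Theorems.HandoffUpperClauses
import Summits.RiemannHypothesis.RiemannHypothesis.Theorems.SemilocalNegCertUptoFortyOne
import Summits.RiemannHypothesis.RiemannHypothesis.Theorems.SemilocalNegCertUptoFortyThree
import Summits.RiemannHypothesis.RiemannHypothesis.Theorems.SemilocalNegCertUptoFortySeven
import Summits.RiemannHypothesis.RiemannHypothesis.Theorems.SemilocalNegCertUptoFiftyThree
import Summits.RiemannHypothesis.RiemannHypothesis.Theorems.SemilocalNegCertUptoFiftyNine
import Summits.RiemannHypothesis.RiemannHypothesis.Theorems.SemilocalNegCertUptoSixtyOneFinal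
import Summits.RiemannHypothesis.RiemannHypothesis.Theorems.SemilocalNegCertUptoSixtySeven
import Summits.RiemannHypothesis.RiemannHypothesis.Theorems.SemilocalNegCertUptoSeventyOne
import Summits.RiemannHypothesis.RiemannHypothesis.Theorems.SemilocalNegCertUptoSeventyThree
import HarnessLib

/-!
# HANDOFF — the RH-free UPPER clauses `a*(S_q) < (log q⁺)/2` as THEOREMS for the primes `43 ≤ q ≤ 79` (cell rh-explicit; A4 Lean lane cc-s2-4 gen9 for TRACK «HANDOFF»)

HONEST FRAMING. Nothing here bears on the truth of RH. `HandoffUpperClauses.lean` (theory-2) made the per-prime UPPER clause of the handoff card —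
«the OLD form `{p < q}` IS negative somewhere on the window of `q`», `a*(S_q) < (log q⁺)/2`, equivalently `0 < r(q)`, `0 < D_q((log q⁺)/2)` — a
TREE THEOREM for `q ≤ 13` from the cc-s2-4 kernel wall certificates. This file does the same bookkeeping for `q = 43, 47, 53, 59, 61, 67, 71, 73, 79`,
from the wall instances of the LIGHT layout (`SemilocalGridMoments.lean`: increment proved once, grid pieces from the moment tables
`SemilocalGridMomentsData*`): `a*(S_43) ≤ 61/32`, `a*(S_47) ≤ 499/256`, `a*(S_53) ≤ 257/128`, `a*(S_59) ≤ 263/128`, `a*(S_61) ≤ 267/128`, `a*(S_67) ≤ 545/256`, `a*(S_71) ≤ 549/256`, `a*(S_73) ≤ 139/64`, `a*(S_79) ≤ 1129/512` (each `< (log q⁺)/2`; the tight ones by `263/64 < log 61` and `549/128 < log 73`).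

* §1 `primesBelow` / `nextPrime` arithmetic; §2 **`a*(S_q) < (log q⁺)/2`** (`weilSemilocalThreshold_primesBelow_*_lt`);
* §3 `0 < r(q)` (`handoffLoad_*_pos`), `0 < D_q((log q⁺)/2)`, non-vacuity `¬ WeilSemilocalPositivityOn S_q ((log q⁺)/2)`, and the one-sided wall
  offsets `δ*(q) ≤ b_q − (log q)/2` (the T2 / UC column) — with `HandoffUpperClauses` and `HandoffUpperClausesB` the upper clause is a THEOREM for
  every prime `q ≤ 79`.

References: H. Yoshida, Adv. Stud. Pure Math. 21 (1992) Prop. 6 (p. 320) (`Yoshida1992HermitianForms`); A. Connes, C. Consani, *Spectral triples and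
ζ-cycles*, Enseign. Math. 69 (2023) 93–148 = arXiv:2106.01715, §2 (`ConnesConsani2023`); the certificates are the tree's (cc-s2-4, `SemilocalNegCert*`).
-/

set_option linter.dupNamespace false  -- the mandated namespace repeats `RiemannHypothesis`

noncomputable section

open Set Literature.NumberTheory.LFunctions
open Summit.RiemannHypothesis.RiemannHypothesis.Theorems
open Summit.RiemannHypothesis.RiemannHypothesis.Theorems.Handoff (ConsecutivePrimes)
open Summit.RiemannHypothesis.RiemannHypothesis.Theorems.HandoffDecomposition
open Summit.RiemannHypothesis.RiemannHypothesis.Theorems.HandoffSemilocalEnergy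
open Summit.RiemannHypothesis.RiemannHypothesis.Theorems.HandoffLoadCeiling
open Summit.RiemannHypothesis.RiemannHypothesis.Theorems.HandoffMarginLaw
open Summit.RiemannHypothesis.RiemannHypothesis.Theorems.MotivicDoor.SemilocalThreshold
open Summit.RiemannHypothesis.RiemannHypothesis.Theorems.SemilocalPolyWitness

namespace Summit.RiemannHypothesis.RiemannHypothesis.Theorems.HandoffUpperClauses

/-! ## §1  Arithmetic of the windows `43 ≤ q ≤ 79` -/

/-- `nextPrime 43 = 47`. [folklore] -/
theorem nextPrime_fortythree : nextPrime 43 = 47 :=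
  nextPrime_eq (by norm_num) (by norm_num) (fun m h1 h2 ↦ by interval_cases m <;> decide)

/-- `(43, 47)` is a consecutive-prime pair. [folklore] -/
theorem consecutivePrimes_fortythree_fortyseven : ConsecutivePrimes 43 47 := by
  have h := consecutivePrimes_nextPrime (show Nat.Prime 43 by norm_num)
  rwa [nextPrime_fortythree] at h

/-- `{p < 43}` as a literal finset. [folklore] -/
theorem primesBelow_fortythree : Nat.primesBelow 43 = {2, 3, 5, 7, 11, 13, 17, 19, 23, 29, 31, 37, 41} := by decide

/-- `nextPrime 47 = 53`. [folklore] -/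
theorem nextPrime_fortyseven : nextPrime 47 = 53 :=
  nextPrime_eq (by norm_num) (by norm_num) (fun m h1 h2 ↦ by interval_cases m <;> decide)

/-- `(47, 53)` is a consecutive-prime pair. [folklore] -/
theorem consecutivePrimes_fortyseven_fiftythree : ConsecutivePrimes 47 53 := by
  have h := consecutivePrimes_nextPrime (show Nat.Prime 47 by norm_num)
  rwa [nextPrime_fortyseven] at h

/-- `{p < 47}` as a literal finset. [folklore] -/
theorem primesBelow_fortyseven : Nat.primesBelow 47 = {2, 3, 5, 7, 11, 13, 17, 19, 23, 29, 31, 37, 41, 43} := by decide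

/-- `nextPrime 53 = 59`. [folklore] -/
theorem nextPrime_fiftythree : nextPrime 53 = 59 :=
  nextPrime_eq (by norm_num) (by norm_num) (fun m h1 h2 ↦ by interval_cases m <;> decide)

/-- `(53, 59)` is a consecutive-prime pair. [folklore] -/
theorem consecutivePrimes_fiftythree_fiftynine : ConsecutivePrimes 53 59 := by
  have h := consecutivePrimes_nextPrime (show Nat.Prime 53 by norm_num)
  rwa [nextPrime_fiftythree] at h

/-- `{p < 53}` as a literal finset. [folklore] -/
theorem primesBelow_fiftythree : Nat.primesBelow 53 = {2, 3, 5, 7, 11, 13, 17, 19, 23, 29, 31, 37, 41, 43, 47} := by decide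

/-- `nextPrime 59 = 61`. [folklore] -/
theorem nextPrime_fiftynine : nextPrime 59 = 61 :=
  nextPrime_eq (by norm_num) (by norm_num) (fun m h1 h2 ↦ by interval_cases m; decide)

/-- `(59, 61)` is a consecutive-prime pair. [folklore] -/
theorem consecutivePrimes_fiftynine_sixtyone : ConsecutivePrimes 59 61 := by
  have h := consecutivePrimes_nextPrime (show Nat.Prime 59 by norm_num)
  rwa [nextPrime_fiftynine] at h

/-- `{p < 59}` as a literal finset. [folklore] -/
theorem primesBelow_fiftynine : Nat.primesBelow 59 = {2, 3, 5, 7, 11, 13, 17, 19, 23, 29, 31, 37, 41, 43, 47, 53} := by decide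

/-- `nextPrime 61 = 67`. [folklore] -/
theorem nextPrime_sixtyone : nextPrime 61 = 67 :=
  nextPrime_eq (by norm_num) (by norm_num) (fun m h1 h2 ↦ by interval_cases m <;> decide)

/-- `(61, 67)` is a consecutive-prime pair. [folklore] -/
theorem consecutivePrimes_sixtyone_sixtyseven : ConsecutivePrimes 61 67 := by
  have h := consecutivePrimes_nextPrime (show Nat.Prime 61 by norm_num)
  rwa [nextPrime_sixtyone] at h

/-- `{p < 61}` as a literal finset. [folklore] -/
theorem primesBelow_sixtyone : Nat.primesBelow 61 = {2, 3, 5, 7, 11, 13, 17, 19, 23, 29, 31, 37, 41, 43, 47, 53, 59} := by decide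

/-- `nextPrime 67 = 71`. [folklore] -/
theorem nextPrime_sixtyseven : nextPrime 67 = 71 :=
  nextPrime_eq (by norm_num) (by norm_num) (fun m h1 h2 ↦ by interval_cases m <;> decide)

/-- `(67, 71)` is a consecutive-prime pair. [folklore] -/
theorem consecutivePrimes_sixtyseven_seventyone : ConsecutivePrimes 67 71 := by
  have h := consecutivePrimes_nextPrime (show Nat.Prime 67 by norm_num)
  rwa [nextPrime_sixtyseven] at h

/-- `{p < 67}` as a literal finset. [folklore] -/
theorem primesBelow_sixtyseven : Nat.primesBelow 67 = {2, 3, 5, 7, 11, 13, 17, 19, 23, 29, 31, 37, 41, 43, 47, 53, 59, 61} := by decide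

/-- `nextPrime 71 = 73`. [folklore] -/
theorem nextPrime_seventyone : nextPrime 71 = 73 :=
  nextPrime_eq (by norm_num) (by norm_num) (fun m h1 h2 ↦ by interval_cases m; decide)

/-- `(71, 73)` is a consecutive-prime pair. [folklore] -/
theorem consecutivePrimes_seventyone_seventythree : ConsecutivePrimes 71 73 := by
  have h := consecutivePrimes_nextPrime (show Nat.Prime 71 by norm_num)
  rwa [nextPrime_seventyone] at h

/-- `{p < 71}` as a literal finset. [folklore] -/
theorem primesBelow_seventyone : Nat.primesBelow 71 = {2, 3, 5, 7, 11, 13, 17, 19, 23, 29, 31, 37, 41, 43, 47, 53, 59, 61, 67} := by decide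

/-- `(73, 79)` is a consecutive-prime pair (`nextPrime 73 = 79` is the tree's `HandoffLadderRungsWide.nextPrime_seventyThree`; kept as a local
step here because that module has no hub olean yet). [folklore] -/
theorem consecutivePrimes_seventythree_seventynine : ConsecutivePrimes 73 79 := by
  have h := consecutivePrimes_nextPrime (show Nat.Prime 73 by norm_num)
  have h73 : nextPrime 73 = 79 := nextPrime_eq (by norm_num) (by norm_num) (fun m h1 h2 ↦ by interval_cases m <;> decide)
  rwa [h73] at h

/-- `{p < 73}` as a literal finset. [folklore] -/
theorem primesBelow_seventythree : Nat.primesBelow 73 = {2, 3, 5, 7, 11, 13, 17, 19, 23, 29, 31, 37, 41, 43, 47, 53, 59, 61, 67, 71} := by decide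

/-- `nextPrime 79 = 83`. [folklore] -/
theorem nextPrime_seventynine : nextPrime 79 = 83 :=
  nextPrime_eq (by norm_num) (by norm_num) (fun m h1 h2 ↦ by interval_cases m <;> decide)

/-- `(79, 83)` is a consecutive-prime pair. [folklore] -/
theorem consecutivePrimes_seventynine_eightythree : ConsecutivePrimes 79 83 := by
  have h := consecutivePrimes_nextPrime (show Nat.Prime 79 by norm_num)
  rwa [nextPrime_seventynine] at h

/-- `{p < 79}` as a literal finset. [folklore] -/
theorem primesBelow_seventynine : Nat.primesBelow 79 = {2, 3, 5, 7, 11, 13, 17, 19, 23, 29, 31, 37, 41, 43, 47, 53, 59, 61, 67, 71, 73} := by decide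

/-! ## §2  The upper clauses `a*(S_q) < (log q⁺)/2`, `43 ≤ q ≤ 79` -/

/-- `263/64 < log 61` (so the `q = 59` window `263/128` sits below `(log 61)/2`; from the tree enclosure `logSixtyOneLo ≤ log 61`). [folklore] -/
theorem log_sixtyone_gt_263_div_64 : (263 : ℝ) / 64 < Real.log 61 := by
  have h := logSixtyOneLo_le
  rw [logSixtyOneLo] at h
  push_cast at h
  linarith

/-- `549/128 < log 73` (so the `q = 71` window `549/256` sits below `(log 73)/2`): `log 73 ≥ log 72 + (1 − 72/73)` with `log 72 = 3 log 2 + 2 log 3`. [folklore] -/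
theorem log_seventythree_gt_549_div_128 : (549 : ℝ) / 128 < Real.log 73 := by
  have h72 : Real.log 72 = 3 * Real.log 2 + 2 * Real.log 3 := by
    rw [show (72 : ℝ) = 2 ^ 3 * 3 ^ 2 by norm_num, Real.log_mul (by norm_num) (by norm_num), Real.log_pow, Real.log_pow]
    push_cast
    ring
  have hq : Real.log 73 = Real.log 72 + Real.log (73 / 72) := by
    rw [← Real.log_mul (by norm_num) (by norm_num)]
    norm_num
  have hlow : 1 - (73 / 72 : ℝ)⁻¹ ≤ Real.log (73 / 72) := Real.one_sub_inv_le_log_of_pos (by norm_num)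
  have h2 := Real.log_two_gt_d9
  have h3 := Real.log_three_gt_d9
  rw [hq, h72]
  norm_num at hlow ⊢
  linarith

/-- **q = 43**: `a*(S_43) < (log 47)/2` (tree `a*(S_43) ≤ 61/32` < (log 46)/2). [cite: Yoshida1992HermitianForms, Prop. 6 (p. 320); tree certificate `SemilocalNegCertUptoFortyOne`] -/
theorem weilSemilocalThreshold_primesBelow_fortythree_lt : weilSemilocalThreshold (Nat.primesBelow 43) < Real.log 47 / 2 := by
  rw [primesBelow_fortythree]
  have h := weilSemilocalThreshold_uptoFortyOne_lt_log_fortysix_half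
  have h2 : Real.log 46 ≤ Real.log 47 := Real.log_le_log (by norm_num) (by norm_num)
  linarith

/-- **q = 47**: `a*(S_47) < (log 53)/2` (tree `a*(S_47) ≤ 499/256` < (log 50)/2). [cite: Yoshida1992HermitianForms, Prop. 6 (p. 320); tree certificate `SemilocalNegCertUptoFortyThree`] -/
theorem weilSemilocalThreshold_primesBelow_fortyseven_lt : weilSemilocalThreshold (Nat.primesBelow 47) < Real.log 53 / 2 := by
  rw [primesBelow_fortyseven]
  have h := weilSemilocalThreshold_uptoFortyThree_lt_log_fifty_half
  have h2 : Real.log 50 ≤ Real.log 53 := Real.log_le_log (by norm_num) (by norm_num)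
  linarith

/-- **q = 53**: `a*(S_53) < (log 59)/2` (tree `a*(S_53) ≤ 257/128` < (log 56)/2). [cite: Yoshida1992HermitianForms, Prop. 6 (p. 320); tree certificate `SemilocalNegCertUptoFortySeven`] -/
theorem weilSemilocalThreshold_primesBelow_fiftythree_lt : weilSemilocalThreshold (Nat.primesBelow 53) < Real.log 59 / 2 := by
  rw [primesBelow_fiftythree]
  have h := weilSemilocalThreshold_uptoFortySeven_lt_log_fiftysix_half
  have h2 : Real.log 56 ≤ Real.log 59 := Real.log_le_log (by norm_num) (by norm_num)
  linarith

/-- **q = 59**: `a*(S_59) < (log 61)/2` (tree `a*(S_59) ≤ 263/128`). [cite: Yoshida1992HermitianForms, Prop. 6 (p. 320); tree certificate `SemilocalNegCertUptoFiftyThree`] -/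
theorem weilSemilocalThreshold_primesBelow_fiftynine_lt : weilSemilocalThreshold (Nat.primesBelow 59) < Real.log 61 / 2 := by
  rw [primesBelow_fiftynine]
  have h := weilSemilocalThreshold_uptoFiftyThree_le
  have hl := log_sixtyone_gt_263_div_64
  push_cast at h
  linarith

/-- **q = 61**: `a*(S_61) < (log 67)/2` (tree `a*(S_61) ≤ 267/128` < (log 65)/2). [cite: Yoshida1992HermitianForms, Prop. 6 (p. 320); tree certificate `SemilocalNegCertUptoFiftyNine`] -/
theorem weilSemilocalThreshold_primesBelow_sixtyone_lt : weilSemilocalThreshold (Nat.primesBelow 61) < Real.log 67 / 2 := by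
  rw [primesBelow_sixtyone]
  have h := weilSemilocalThreshold_uptoFiftyNine_lt_log_sixtyfive_half
  have h2 : Real.log 65 ≤ Real.log 67 := Real.log_le_log (by norm_num) (by norm_num)
  linarith

/-- **q = 67**: `a*(S_67) < (log 71)/2` (tree `a*(S_67) ≤ 545/256` < (log 71)/2). [cite: Yoshida1992HermitianForms, Prop. 6 (p. 320); tree certificate `SemilocalNegCertUptoSixtyOne`] -/
theorem weilSemilocalThreshold_primesBelow_sixtyseven_lt : weilSemilocalThreshold (Nat.primesBelow 67) < Real.log 71 / 2 := by
  rw [primesBelow_sixtyseven]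
  exact weilSemilocalThreshold_uptoSixtyOne_lt_log_seventyone_half

/-- **q = 71**: `a*(S_71) < (log 73)/2` (tree `a*(S_71) ≤ 549/256`). [cite: Yoshida1992HermitianForms, Prop. 6 (p. 320); tree certificate `SemilocalNegCertUptoSixtySeven`] -/
theorem weilSemilocalThreshold_primesBelow_seventyone_lt : weilSemilocalThreshold (Nat.primesBelow 71) < Real.log 73 / 2 := by
  rw [primesBelow_seventyone]
  have h := weilSemilocalThreshold_uptoSixtySeven_le
  have hl := log_seventythree_gt_549_div_128
  push_cast at h
  linarith

/-- **q = 73**: `a*(S_73) < (log 79)/2` (tree `a*(S_73) ≤ 139/64` < (log 78)/2). [cite: Yoshida1992HermitianForms, Prop. 6 (p. 320); tree certificate `SemilocalNegCertUptoSeventyOne`] -/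
theorem weilSemilocalThreshold_primesBelow_seventythree_lt : weilSemilocalThreshold (Nat.primesBelow 73) < Real.log 79 / 2 := by
  rw [primesBelow_seventythree]
  have h := weilSemilocalThreshold_uptoSeventyOne_lt_log_seventyeight_half
  have h2 : Real.log 78 ≤ Real.log 79 := Real.log_le_log (by norm_num) (by norm_num)
  linarith

/-- **q = 79**: `a*(S_79) < (log 83)/2` (tree `a*(S_79) ≤ 1129/512` < (log 83)/2). [cite: Yoshida1992HermitianForms, Prop. 6 (p. 320); tree certificate `SemilocalNegCertUptoSeventyThree`] -/
theorem weilSemilocalThreshold_primesBelow_seventynine_lt : weilSemilocalThreshold (Nat.primesBelow 79) < Real.log 83 / 2 := by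
  rw [primesBelow_seventynine]
  exact weilSemilocalThreshold_uptoSeventyThree_lt_log_eightythree_half

/-! ## §3  Consequences: positive loads, aggregate deficits, non-vacuity, one-sided wall offsets -/

/-- **`0 < r(43)`** (RH-free). [this track] -/
theorem handoffLoad_fortythree_fortyseven_pos : 0 < handoffLoad 43 47 :=
  (handoffLoad_pos_iff consecutivePrimes_fortythree_fortyseven).2 weilSemilocalThreshold_primesBelow_fortythree_lt

/-- **`0 < r(47)`** (RH-free). [this track] -/
theorem handoffLoad_fortyseven_fiftythree_pos : 0 < handoffLoad 47 53 :=
  (handoffLoad_pos_iff consecutivePrimes_fortyseven_fiftythree).2 weilSemilocalThreshold_primesBelow_fortyseven_lt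

/-- **`0 < r(53)`** (RH-free). [this track] -/
theorem handoffLoad_fiftythree_fiftynine_pos : 0 < handoffLoad 53 59 :=
  (handoffLoad_pos_iff consecutivePrimes_fiftythree_fiftynine).2 weilSemilocalThreshold_primesBelow_fiftythree_lt

/-- **`0 < r(59)`** (RH-free). [this track] -/
theorem handoffLoad_fiftynine_sixtyone_pos : 0 < handoffLoad 59 61 :=
  (handoffLoad_pos_iff consecutivePrimes_fiftynine_sixtyone).2 weilSemilocalThreshold_primesBelow_fiftynine_lt

/-- **`0 < r(61)`** (RH-free). [this track] -/
theorem handoffLoad_sixtyone_sixtyseven_pos : 0 < handoffLoad 61 67 :=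
  (handoffLoad_pos_iff consecutivePrimes_sixtyone_sixtyseven).2 weilSemilocalThreshold_primesBelow_sixtyone_lt

/-- **`0 < r(67)`** (RH-free). [this track] -/
theorem handoffLoad_sixtyseven_seventyone_pos : 0 < handoffLoad 67 71 :=
  (handoffLoad_pos_iff consecutivePrimes_sixtyseven_seventyone).2 weilSemilocalThreshold_primesBelow_sixtyseven_lt

/-- **`0 < r(71)`** (RH-free). [this track] -/
theorem handoffLoad_seventyone_seventythree_pos : 0 < handoffLoad 71 73 :=
  (handoffLoad_pos_iff consecutivePrimes_seventyone_seventythree).2 weilSemilocalThreshold_primesBelow_seventyone_lt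

/-- **`0 < r(73)`** (RH-free). [this track] -/
theorem handoffLoad_seventythree_seventynine_pos : 0 < handoffLoad 73 79 :=
  (handoffLoad_pos_iff consecutivePrimes_seventythree_seventynine).2 weilSemilocalThreshold_primesBelow_seventythree_lt

/-- **`0 < r(79)`** (RH-free). [this track] -/
theorem handoffLoad_seventynine_eightythree_pos : 0 < handoffLoad 79 83 :=
  (handoffLoad_pos_iff consecutivePrimes_seventynine_eightythree).2 weilSemilocalThreshold_primesBelow_seventynine_lt

/-- The aggregate deficits at the window ends are STRICTLY positive: `0 < D_q((log q⁺)/2)`, `43 ≤ q ≤ 79`. [this track] -/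
theorem aggregateDeficit_pos_fortythree_to_seventynine :
    0 < aggregateDeficit 43 (Real.log 47 / 2) ∧
      0 < aggregateDeficit 47 (Real.log 53 / 2) ∧
      0 < aggregateDeficit 53 (Real.log 59 / 2) ∧
      0 < aggregateDeficit 59 (Real.log 61 / 2) ∧
      0 < aggregateDeficit 61 (Real.log 67 / 2) ∧
      0 < aggregateDeficit 67 (Real.log 71 / 2) ∧
      0 < aggregateDeficit 71 (Real.log 73 / 2) ∧
      0 < aggregateDeficit 73 (Real.log 79 / 2) ∧
      0 < aggregateDeficit 79 (Real.log 83 / 2) :=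
  ⟨aggregateDeficit_pos_iff.2 weilSemilocalThreshold_primesBelow_fortythree_lt,
    aggregateDeficit_pos_iff.2 weilSemilocalThreshold_primesBelow_fortyseven_lt,
    aggregateDeficit_pos_iff.2 weilSemilocalThreshold_primesBelow_fiftythree_lt,
    aggregateDeficit_pos_iff.2 weilSemilocalThreshold_primesBelow_fiftynine_lt,
    aggregateDeficit_pos_iff.2 weilSemilocalThreshold_primesBelow_sixtyone_lt,
    aggregateDeficit_pos_iff.2 weilSemilocalThreshold_primesBelow_sixtyseven_lt,
    aggregateDeficit_pos_iff.2 weilSemilocalThreshold_primesBelow_seventyone_lt,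
    aggregateDeficit_pos_iff.2 weilSemilocalThreshold_primesBelow_seventythree_lt,
    aggregateDeficit_pos_iff.2 weilSemilocalThreshold_primesBelow_seventynine_lt⟩

/-- **Non-vacuity of the handoff, `43 ≤ q ≤ 79`**: the OLD form `{p < q}` is NOT non-negative on the window end of `q`. [cite: ConnesConsani2023, §2.2–2.4; this track] -/
theorem not_weilSemilocalPositivityOn_window_end_fortythree_to_seventynine :
    ¬ WeilSemilocalPositivityOn (Nat.primesBelow 43) (Real.log 47 / 2) ∧
      ¬ WeilSemilocalPositivityOn (Nat.primesBelow 47) (Real.log 53 / 2) ∧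
      ¬ WeilSemilocalPositivityOn (Nat.primesBelow 53) (Real.log 59 / 2) ∧
      ¬ WeilSemilocalPositivityOn (Nat.primesBelow 59) (Real.log 61 / 2) ∧
      ¬ WeilSemilocalPositivityOn (Nat.primesBelow 61) (Real.log 67 / 2) ∧
      ¬ WeilSemilocalPositivityOn (Nat.primesBelow 67) (Real.log 71 / 2) ∧
      ¬ WeilSemilocalPositivityOn (Nat.primesBelow 71) (Real.log 73 / 2) ∧
      ¬ WeilSemilocalPositivityOn (Nat.primesBelow 73) (Real.log 79 / 2) ∧
      ¬ WeilSemilocalPositivityOn (Nat.primesBelow 79) (Real.log 83 / 2) := by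
  simp only [not_weilSemilocalPositivityOn_iff_weilSemilocalThreshold_lt]
  exact ⟨weilSemilocalThreshold_primesBelow_fortythree_lt,
    weilSemilocalThreshold_primesBelow_fortyseven_lt,
    weilSemilocalThreshold_primesBelow_fiftythree_lt,
    weilSemilocalThreshold_primesBelow_fiftynine_lt,
    weilSemilocalThreshold_primesBelow_sixtyone_lt,
    weilSemilocalThreshold_primesBelow_sixtyseven_lt,
    weilSemilocalThreshold_primesBelow_seventyone_lt,
    weilSemilocalThreshold_primesBelow_seventythree_lt,
    weilSemilocalThreshold_primesBelow_seventynine_lt⟩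

/-- `δ*(43) ≤ 61/32 − (log 43)/2` (one-sided, RH-free; the T2/UC column). [this track; tree certificate `SemilocalNegCertUptoFortyOne`] -/
theorem wallOffset_fortythree_le : wallOffset 43 ≤ 61 / 32 - Real.log 43 / 2 := by
  have h := weilSemilocalThreshold_uptoFortyOne_le
  push_cast at h
  rw [wallOffset, primesBelow_fortythree]
  push_cast
  linarith

/-- `δ*(47) ≤ 499/256 − (log 47)/2` (one-sided, RH-free; the T2/UC column). [this track; tree certificate `SemilocalNegCertUptoFortyThree`] -/
theorem wallOffset_fortyseven_le : wallOffset 47 ≤ 499 / 256 - Real.log 47 / 2 := by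
  have h := weilSemilocalThreshold_uptoFortyThree_le
  push_cast at h
  rw [wallOffset, primesBelow_fortyseven]
  push_cast
  linarith

/-- `δ*(53) ≤ 257/128 − (log 53)/2` (one-sided, RH-free; the T2/UC column). [this track; tree certificate `SemilocalNegCertUptoFortySeven`] -/
theorem wallOffset_fiftythree_le : wallOffset 53 ≤ 257 / 128 - Real.log 53 / 2 := by
  have h := weilSemilocalThreshold_uptoFortySeven_le
  push_cast at h
  rw [wallOffset, primesBelow_fiftythree]
  push_cast
  linarith

/-- `δ*(59) ≤ 263/128 − (log 59)/2` (one-sided, RH-free; the T2/UC column). [this track; tree certificate `SemilocalNegCertUptoFiftyThree`] -/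
theorem wallOffset_fiftynine_le : wallOffset 59 ≤ 263 / 128 - Real.log 59 / 2 := by
  have h := weilSemilocalThreshold_uptoFiftyThree_le
  push_cast at h
  rw [wallOffset, primesBelow_fiftynine]
  push_cast
  linarith

/-- `δ*(61) ≤ 267/128 − (log 61)/2` (one-sided, RH-free; the T2/UC column). [this track; tree certificate `SemilocalNegCertUptoFiftyNine`] -/
theorem wallOffset_sixtyone_le : wallOffset 61 ≤ 267 / 128 - Real.log 61 / 2 := by
  have h := weilSemilocalThreshold_uptoFiftyNine_le
  push_cast at h
  rw [wallOffset, primesBelow_sixtyone]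
  push_cast
  linarith

/-- `δ*(67) ≤ 545/256 − (log 67)/2` (one-sided, RH-free; the T2/UC column). [this track; tree certificate `SemilocalNegCertUptoSixtyOne`] -/
theorem wallOffset_sixtyseven_le : wallOffset 67 ≤ 545 / 256 - Real.log 67 / 2 := by
  have h := weilSemilocalThreshold_uptoSixtyOne_le
  push_cast at h
  rw [wallOffset, primesBelow_sixtyseven]
  push_cast
  linarith

/-- `δ*(71) ≤ 549/256 − (log 71)/2` (one-sided, RH-free; the T2/UC column). [this track; tree certificate `SemilocalNegCertUptoSixtySeven`] -/
theorem wallOffset_seventyone_le : wallOffset 71 ≤ 549 / 256 - Real.log 71 / 2 := by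
  have h := weilSemilocalThreshold_uptoSixtySeven_le
  push_cast at h
  rw [wallOffset, primesBelow_seventyone]
  push_cast
  linarith

/-- `δ*(73) ≤ 139/64 − (log 73)/2` (one-sided, RH-free; the T2/UC column). [this track; tree certificate `SemilocalNegCertUptoSeventyOne`] -/
theorem wallOffset_seventythree_le : wallOffset 73 ≤ 139 / 64 - Real.log 73 / 2 := by
  have h := weilSemilocalThreshold_uptoSeventyOne_le
  push_cast at h
  rw [wallOffset, primesBelow_seventythree]
  push_cast
  linarith

/-- `δ*(79) ≤ 1129/512 − (log 79)/2` (one-sided, RH-free; the T2/UC column). [this track; tree certificate `SemilocalNegCertUptoSeventyThree`] -/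
theorem wallOffset_seventynine_le : wallOffset 79 ≤ 1129 / 512 - Real.log 79 / 2 := by
  have h := weilSemilocalThreshold_uptoSeventyThree_le
  push_cast at h
  rw [wallOffset, primesBelow_seventynine]
  push_cast
  linarith

end Summit.RiemannHypothesis.RiemannHypothesis.Theorems.HandoffUpperClauses

end
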